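import Summits.CriticalPhenomena.PercolationContinuityZ3.Theorems.Transplant.SkelPhiParaFrameChangeFine
import HarnessLib

/-!
# N1 (the `{±1}` node), LEVEL 1, (C) column file (C-N6b): READING AN ARBITRARY (OFF-CENTRE) RUN BOX INTO THE FINE CELL MAP — the band's far cores
# and regions `Icc lo hi` of the run frame `runX φ c₀ n h σ` (NOT symmetric about the run origin) give SIGNED fine intervals about `ρ(c₀)`:
# along `ρ₀` through p1-g11's signed reading `coarseSkel_zero_sub_bounds` (`a₁ ≤ Δα ≤ a₂`, `|Δβ′| ≤ B`), across `ρ₁` through `coarseSkel_one_sub_bounds`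
# (`b₁' ≤ Δβ′ ≤ b₂'` from the floored transverse coordinate), each at its own multiplier; hence `WinIn (runX …) Ω (Icc lo hi) ⊆ WinIn (fineSkel …) Ω (Icc LO HI)`
# for any fine box `[LO, HI]` containing the computed intervals — the form in which the LAST CORE of the (C) band is placed inside `M_{y+du} ∩ H_{y,du}`.

builds on p205010 (kernel theorem, internal audit signed; external expert review pending) — nothing in this file uses p205010; nothing here is a
claim about the open node `SamePDropOfSkeletonNeg`.
Lane `prim-bschramm`, seat `prim-bschramm-p5` (gen 8; (C) lineage); helper file (`--supports stmt-CriticalPhenomena-4575`).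
* `run_signed_bounds_of_mem_Icc` (`runX … v ∈ Icc lo hi`, `σ = 1` ⇒ `lo 0 ≤ Δα ≤ hi 0`, `U·lo 1 ≤ Δβ′ ≤ U·hi 1 + U − 1`);
* **`fine_sub_bounds_of_runX_mem_Icc`** (the two signed fine intervals), **`winIn_runX_subset_winIn_fine_box`**.
[cite: MartineauTassion2017, §4.1] [cite: KozmaNitzan2024, §4 Lemma 12 (pp. 23–25)]
-/

noncomputable section

namespace Summit.CriticalPhenomena.PercolationContinuityZ3.Theorems.Transplant

namespace Skelφ

open Literature.Probability.Percolation Literature.Probability.LatticeModels SimpleGraph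
open TwoAxis.Para (coarse lam0 lam1 modulus)

variable {V : Type} {G : SimpleGraph V} {φ : V → Site 2}

/-- **Run box ⇒ signed raw bounds** (frame sign `σ = 1`): `runX φ c₀ n h 1 v ∈ Icc lo hi` gives `lo 0 ≤ Δα ≤ hi 0` and
`U·lo 1 ≤ Δβ′ ≤ U·hi 1 + U − 1` (`U = n + |h|`). [folklore] -/
theorem run_signed_bounds_of_mem_Icc {n : ℕ} (hn : 1 ≤ n) (c₀ : V) (h : ℤ) {lo hi : Site 2} {v : V} (hv : runX φ c₀ n h 1 v ∈ Finset.Icc lo hi) :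
    lo 0 ≤ relCoord φ c₀ 0 v ∧ relCoord φ c₀ 0 v ≤ hi 0 ∧
      (shearUnit n h : ℤ) * lo 1 ≤ shearCoord φ c₀ n h v ∧ shearCoord φ c₀ n h v ≤ (shearUnit n h : ℤ) * hi 1 + shearUnit n h - 1 := by
  rw [Finset.mem_Icc, Pi.le_def, Pi.le_def, Fin.forall_fin_two, Fin.forall_fin_two] at hv
  simp only [runX_zero, runX_one, one_mul] at hv
  obtain ⟨⟨h0l, h1l⟩, h0u, h1u⟩ := hv
  obtain ⟨hb1, hb2⟩ := shearCoord_bounds_of_floor_bounds (φ := φ) hn c₀ h 1 v (by simpa using h1l) (by simpa using h1u)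
  simp only [one_mul] at hb1 hb2
  exact ⟨h0l, h0u, hb1, hb2⟩

/-- **An off-centre run box read into the fine cell map**: for `runX φ c₀ n h 1 v ∈ Icc lo hi` (so `lo 0 ≤ Δα ≤ hi 0`, `U·lo 1 ≤ Δβ′ ≤ U·hi 1 + U − 1`, and
`|Δβ′| ≤ B` for any `B ≥ U·max(|lo 1|, |hi 1| + 1)`), the fine position of `v` relative to that of `c₀` satisfies
`⌊c₀'⌊A(m·lo 0 − |vα|B)/n⌋/D⌋ ≤ Δρ₀ ≤ ⌊c₀'⌊A(m·hi 0 + |vα|B)/n⌋/D⌋ + 1` and `⌊c₁'A·U·lo 1/D⌋ ≤ Δρ₁ ≤ ⌊c₁'A·(U·hi 1 + U − 1)/D⌋ + 1`.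
[cite: MartineauTassion2017, §4.1] [cite: KozmaNitzan2024, §4 Lemma 11 (p. 22)] -/
theorem fine_sub_bounds_of_runX_mem_Icc (t₀ : V) {A : ℤ} (hA : 0 ≤ A) {n : ℕ} (hn : 1 ≤ n) {h vα vβ : ℤ} (hm : 0 ≤ modulus n h vα vβ)
    {c₀' c₁' s₀ s₁ D : ℤ} (hc₀ : 0 ≤ c₀') (hc₁ : 0 ≤ c₁') (hD : 0 < D) (c₀ : V) {lo hi : Site 2} {B : ℤ}
    (hBlo : -B ≤ (shearUnit n h : ℤ) * lo 1) (hBhi : (shearUnit n h : ℤ) * hi 1 + shearUnit n h - 1 ≤ B) {v : V}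
    (hv : runX φ c₀ n h 1 v ∈ Finset.Icc lo hi) :
    ((c₀' * (A * (modulus n h vα vβ * lo 0 - |vα| * B) / n)) / D ≤
        fineSkel φ t₀ A n h vα vβ c₀' c₁' s₀ s₁ D v 0 - fineSkel φ t₀ A n h vα vβ c₀' c₁' s₀ s₁ D c₀ 0 ∧
      fineSkel φ t₀ A n h vα vβ c₀' c₁' s₀ s₁ D v 0 - fineSkel φ t₀ A n h vα vβ c₀' c₁' s₀ s₁ D c₀ 0 ≤
        (c₀' * (A * (modulus n h vα vβ * hi 0 + |vα| * B) / n)) / D + 1) ∧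
    ((c₁' * (A * ((shearUnit n h : ℤ) * lo 1))) / D ≤
        fineSkel φ t₀ A n h vα vβ c₀' c₁' s₀ s₁ D v 1 - fineSkel φ t₀ A n h vα vβ c₀' c₁' s₀ s₁ D c₀ 1 ∧
      fineSkel φ t₀ A n h vα vβ c₀' c₁' s₀ s₁ D v 1 - fineSkel φ t₀ A n h vα vβ c₀' c₁' s₀ s₁ D c₀ 1 ≤
        (c₁' * (A * ((shearUnit n h : ℤ) * hi 1 + shearUnit n h - 1))) / D + 1) := by
  obtain ⟨ha1, ha2, hb1, hb2⟩ := run_signed_bounds_of_mem_Icc hn c₀ h hv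
  have hB : |shearCoord φ c₀ n h v| ≤ B := abs_le.2 ⟨by linarith, by linarith⟩
  have e0 : ∀ w : V, fineSkel φ t₀ A n h vα vβ c₀' c₁' s₀ s₁ D w 0 = coarseSkel φ t₀ A n h vα vβ c₀' s₀ s₁ D w 0 := fun w => rfl
  have e1 : ∀ w : V, fineSkel φ t₀ A n h vα vβ c₀' c₁' s₀ s₁ D w 1 = coarseSkel φ t₀ A n h vα vβ c₁' s₀ s₁ D w 1 := fun w => rfl
  rw [e0, e0, e1, e1]
  exact ⟨coarseSkel_zero_sub_bounds hA hn hm hc₀ hD t₀ c₀ v ha1 ha2 hB, coarseSkel_one_sub_bounds hA n h vα vβ hc₁ hD t₀ c₀ v hb1 hb2⟩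

/-- **AN OFF-CENTRE RUN WINDOW LIES IN A FINE-CELL WINDOW**: inside any habitat `Ω`, the window over the run box `Icc lo hi` of `runX φ c₀ n h 1` lies in the
window over any fine box `Icc LO HI` with `LO ≤ ρ(c₀) + (lower readings)` and `ρ(c₀) + (upper readings) + 1 ≤ HI` coordinatewise.
[cite: KozmaNitzan2024, §4 Lemma 12 (pp. 23–25)] -/
theorem winIn_runX_subset_winIn_fine_box [DecidableEq V] (t₀ : V) {A : ℤ} (hA : 0 ≤ A) {n : ℕ} (hn : 1 ≤ n) {h vα vβ : ℤ} (hm : 0 ≤ modulus n h vα vβ)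
    {c₀' c₁' s₀ s₁ D : ℤ} (hc₀ : 0 ≤ c₀') (hc₁ : 0 ≤ c₁') (hD : 0 < D) (c₀ : V) {lo hi LO HI : Site 2} {B : ℤ}
    (hBlo : -B ≤ (shearUnit n h : ℤ) * lo 1) (hBhi : (shearUnit n h : ℤ) * hi 1 + shearUnit n h - 1 ≤ B)
    (hLO0 : LO 0 ≤ fineSkel φ t₀ A n h vα vβ c₀' c₁' s₀ s₁ D c₀ 0 + (c₀' * (A * (modulus n h vα vβ * lo 0 - |vα| * B) / n)) / D)
    (hHI0 : fineSkel φ t₀ A n h vα vβ c₀' c₁' s₀ s₁ D c₀ 0 + (c₀' * (A * (modulus n h vα vβ * hi 0 + |vα| * B) / n)) / D + 1 ≤ HI 0)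
    (hLO1 : LO 1 ≤ fineSkel φ t₀ A n h vα vβ c₀' c₁' s₀ s₁ D c₀ 1 + (c₁' * (A * ((shearUnit n h : ℤ) * lo 1))) / D)
    (hHI1 : fineSkel φ t₀ A n h vα vβ c₀' c₁' s₀ s₁ D c₀ 1 + (c₁' * (A * ((shearUnit n h : ℤ) * hi 1 + shearUnit n h - 1))) / D + 1 ≤ HI 1)
    (Ω : Finset V) :
    WinIn (runX φ c₀ n h 1) Ω (Finset.Icc lo hi) ⊆ WinIn (fineSkel φ t₀ A n h vα vβ c₀' c₁' s₀ s₁ D) Ω (Finset.Icc LO HI) := by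
  intro g hg
  rw [mem_WinIn] at hg ⊢
  obtain ⟨hgΩ, hgr⟩ := hg
  obtain ⟨⟨h0l, h0u⟩, h1l, h1u⟩ := fine_sub_bounds_of_runX_mem_Icc (s₀ := s₀) (s₁ := s₁) t₀ hA hn hm hc₀ hc₁ hD c₀ hBlo hBhi hgr
  refine ⟨hgΩ, ?_⟩
  rw [Finset.mem_Icc, Pi.le_def, Pi.le_def, Fin.forall_fin_two, Fin.forall_fin_two]
  exact ⟨⟨by linarith, by linarith⟩, by linarith, by linarith⟩

end Skelφ

end Summit.CriticalPhenomena.PercolationContinuityZ3.Theorems.Transplant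

end
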